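import Literature.AnabelianGeometry.EtaleTheta.FrobenioidCyclotomicRigidityProjGalois
import Literature.AnabelianGeometry.EtaleTheta.Discharge.Sec5Rho219PinLaws
import HarnessLib

/-!
# [EtTh] Lemma 5.9 (v), §2 slot pinned — the consumer head RE-KEYED to the v2 subquotient record `ThetaSubquotientProjGalois`
# (surjectivity at Galois objects only; proof-only)

Mochizuki, *The étale theta function and its Frobenioid-theoretic manifestations*, Publ. RIMS **45** (2009), Lemma 5.9 (v) p. 332
(PDF p. 106): «In the situation of (iv), the cyclotomic rigidity isomorphism arising from the theory of §2 [cf. Corollary 2.19, (i)]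
coincides with the Frobenioid-theoretic isomorphism of Proposition 5.5 [where we take "`S`" to be `B_N`].»
[cite: MochizukiEtTh2009, Lem 5.9 (v) p.332 (PDF p.106)]; Prop. 5.5 p. 327 (PDF p. 101); §5 p. 327 («these subquotients determine
subquotients `Aut_D(D) ↠ Aut^Θ_D(D)`») [cite: MochizukiEtTh2009, §5 p.327 (PDF p.101)].

abc-iut cell, layer L2, seat abc-iut-w6-d079 (gen 6), row «PROJ-SURJ-PLAN-A» step (3) (abc-iut-L2-lead gen 6 R847: «re-key ONE consumer head
to v2, leaving the v1 heads as settled vacuous-at-stub twins»).  PROOF-ONLY (0 definitions).  The consumer head of record is the GENERIC head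
of abc-iut-w4-d042's `Sec5Lem59vOfConnectedTemperoidLevelN.lean` (p471697), `ThetaFrobenioid.cycRigidityCoincide_rho219_of_envIsoBiTheta_of_rowTwo`,
which binds `(P : ThetaSubquotientProj 𝔉)` — abc-iut-L2-t4's v1 record, EMPTY at abc-iut-L2-t9's carrier at the root model (p476337) — only
through `P.pre` / `P.proj` at `Base(B_N)` and the Prop. 5.5 clause `IsKummerDetermined 𝔉 P ρ hB`.  Here the SAME chain is re-derived
VERBATIM (proof scripts of abc-iut-w4-d042's `Sec5Lem59vTransport` / `Sec5Rho219Pin` / `Sec5Rho219PinLaws`, pointers in each docstring) for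
`P : ThetaSubquotientProjGalois 𝔉 Gal` (abc-iut-w6-d079's v2 record, `FrobenioidCyclotomicRigidityProjGalois.lean` p481123, INHABITED at
that carrier: `Sec5ThetaSubquotientProjGaloisInhabited.lean`) with the Prop. 5.5 clause read on the v2 record
(`ThetaSubquotientProjGalois.IsKummerDetermined`, the same formula):

* `biThetaIso_muIncl_rigidity_galois`, `cycRigidityCoincide_of_biTheta_galois` (↔ `Sec5Lem59vTransport`),
* `cycRigidityCoincide_rho219OfBiTheta_galois` (↔ `Sec5Rho219Pin`; the `Δ`-leg law `IsDeltaLeg` — a v1-typed `def` — is consumed INLINED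
  as the hypothesis `hψ`, so no new definition is needed),
* `deltaLeg_of_rowTwo_galois`, `cover_of_laws_galois`, `cycRigidityCoincide_rho219OfBiTheta_of_rowTwo_galois` (↔ `Sec5Rho219PinLaws`),
* **`cycRigidityCoincide_rho219_of_envIsoBiTheta_of_rowTwo_galois`** — THE RE-KEYED HEAD: Lemma 5.9 (v) with the §2 slot pinned, from
  Lemma 5.9 (iv) BY NAME (`EnvIsoBiTheta`) + Prop. 5.5 BY NAME on the v2 record + the row-2 laws (hpre/hlift/hP), for every
  `P : ThetaSubquotientProjGalois 𝔉 Gal` and every `Gal`;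
* `cycRigidityCoincide_rho219_of_envIsoBiTheta_of_rowTwo_of_toGalois` — the v1 head IS the v2 head at `P.toGalois Gal` (twin check: the
  old head is an instance of the new one; nothing of p471697 is edited).

HONEST FRAMING: kernel-checked implications between the cell's typed statements; nothing asserts that such data exist for an actual curve;
[EtTh] is refereed; nothing here bears on [IUTchIII] Cor. 3.12 — no side taken; typed ≠ proved.
-/

noncomputable section

namespace Literature.AnabelianGeometry.EtaleTheta

open CategoryTheory
open FrobenioidCyclotomicRigidity

universe w v v' u u'

namespace ThetaFrobenioid

variable {C : Type u} [Category.{v} C] {D : Type u'} [Category.{v'} D] (𝔉 : ThetaFrobenioid.{w} C D)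
  (h1 : 𝔉.SectionsFactor) (h3 : 𝔉.OuterActionLZ) (hsec : 𝔉.SgpCapSection) (hcs : 𝔉.SgpCupSection)
  (h8 : 𝔉.ConstantsEqNormalizer) (DK : Set (TopOut 𝔉.EPiN)) {Gal : D → Prop}

/-! ## 1. Lemma 5.9 (v) elementwise and in `CycRigidityCoincide` form, over an abstract theta environment datum `T` -/

section Env

variable {N : ℕ+} (T : ThetaEnvData.{v} N) (ι : 𝔉.PiX ≃ₜ* T.PiX)
  {η : T.PiYdd → T.mu} (hη : η ∈ T.thetaCocycles)
  (i : (𝔉.frdBiThetaEnv h1 h3 hsec hcs h8 DK).Iso (T.modelBi hη))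

/-- **Lemma 5.9 (v), ELEMENTWISE, on the v2 record** (abc-iut-w4-d042's `biThetaIso_muIncl_rigidity` with
`P : ThetaSubquotientProjGalois 𝔉 Gal`): with Prop. 5.5's clause read on the v2 record, for `y ∈ Π^tp_Ÿ̲` over `Δ` with `ρ y` in the theta
pre-subgroup, the Prop. 5.5 rigidity isomorphism at `[proj(ρ y)]`, carried into `Π^tp_Y[μ_N]` by the isomorphism of (iv), is `μ(η(ι y))`.
[cite: MochizukiEtTh2009, Lem 5.9 (v) p.332 (PDF p.106)] -/
theorem biThetaIso_muIncl_rigidity_galois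
    (hi : ∀ x : 𝔉.EPiN, ((CycEnvelope.proj T.augY T.chi (i.e x) : T.PiY) : T.PiX) = ι (𝔉.toPiY x))
    (hYdd : 𝔉.PiYdd.map ι.toMonoidHom = T.PiYdd) (P : ThetaSubquotientProjGalois 𝔉 Gal) (ρ : RigidityFamily 𝔉)
    (hB : 𝔉.IsThetaSaturated 𝔉.BN) (hρ : P.IsKummerDetermined ρ hB) (y : 𝔉.PiYdd)
    (hy : T.aug (ι (y : 𝔉.PiX)) = 1)
    (hh : ((𝔉.rhoYdd y : 𝔉.HB) : Aut (𝔉.base.obj 𝔉.BN)) ∈ P.pre (𝔉.base.obj 𝔉.BN)) :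
    i.e (𝔉.muIncl (ρ 𝔉.BN hB (QuotientGroup.mk (P.proj _ ⟨_, hh⟩)))) =
      CycEnvelope.inMu T.augY T.chi (η ⟨ι (y : 𝔉.PiX), 𝔉.iota_mem_PiYdd T ι hYdd y⟩) := by
  rw [← 𝔉.biThetaIso_sCapPi_mul_sCupPi_inv h1 h3 hsec hcs h8 DK T ι hη i hi hYdd y hy]
  congr 1
  apply Subtype.ext
  apply Prod.ext
  · rw [coe_muIncl, coe_sCapPi_mul_sCupPi_inv_fst, hρ]
    rfl
  · obtain ⟨u, hu⟩ := 𝔉.sCapPi_mul_sCupPi_inv_mem_range_muIncl h1 hsec hcs y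
    rw [← hu, coe_muIncl, coe_muIncl]

/-- **Lemma 5.9 (v) in abc-iut-L2-t4's typed form, on the v2 record** (abc-iut-w4-d042's `cycRigidityCoincide_of_biTheta`): for a §2-side
slot `ρ219` characterised as "the §2 identification transported by the isomorphism of (iv)" on a covering family, `ρ_{B_N} = ρ219`.
[cite: MochizukiEtTh2009, Lem 5.9 (v) p.332 (PDF p.106)] -/
theorem cycRigidityCoincide_of_biTheta_galois
    (hi : ∀ x : 𝔉.EPiN, ((CycEnvelope.proj T.augY T.chi (i.e x) : T.PiY) : T.PiX) = ι (𝔉.toPiY x))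
    (hYdd : 𝔉.PiYdd.map ι.toMonoidHom = T.PiYdd) (P : ThetaSubquotientProjGalois 𝔉 Gal) (ρ : RigidityFamily 𝔉)
    (hB : 𝔉.IsThetaSaturated 𝔉.BN) (hρ : P.IsKummerDetermined ρ hB)
    (ρ219 : 𝔉.lDeltaModN 𝔉.BN ≃* 𝔉.muTorsion 𝔉.BN 𝔉.N)
    (hcov : ∀ x : 𝔉.lDeltaModN 𝔉.BN, ∃ (y : 𝔉.PiYdd) (_ : T.aug (ι (y : 𝔉.PiX)) = 1)
      (hh : ((𝔉.rhoYdd y : 𝔉.HB) : Aut (𝔉.base.obj 𝔉.BN)) ∈ P.pre (𝔉.base.obj 𝔉.BN)),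
      (QuotientGroup.mk (P.proj _ ⟨_, hh⟩) : 𝔉.lDeltaModN 𝔉.BN) = x)
    (hρ219 : ∀ (y : 𝔉.PiYdd) (_ : T.aug (ι (y : 𝔉.PiX)) = 1)
      (hh : ((𝔉.rhoYdd y : 𝔉.HB) : Aut (𝔉.base.obj 𝔉.BN)) ∈ P.pre (𝔉.base.obj 𝔉.BN)),
      i.e (𝔉.muIncl (ρ219 (QuotientGroup.mk (P.proj _ ⟨_, hh⟩)))) =
        CycEnvelope.inMu T.augY T.chi (η ⟨ι (y : 𝔉.PiX), 𝔉.iota_mem_PiYdd T ι hYdd y⟩)) :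
    𝔉.CycRigidityCoincide ρ219 ρ hB := by
  apply MulEquiv.ext
  intro x
  obtain ⟨y, hy, hh, rfl⟩ := hcov x
  have hinj : Function.Injective 𝔉.muIncl := fun a b hab =>
    Subtype.ext (by simpa only [coe_muIncl] using congrArg (fun z : 𝔉.EPiN => (z : Aut 𝔉.BN × 𝔉.PiX).1) hab)
  apply hinj
  apply i.e.injective
  rw [𝔉.biThetaIso_muIncl_rigidity_galois h1 h3 hsec hcs h8 DK T ι hη i hi hYdd P ρ hB hρ y hy hh, hρ219 y hy hh]

/-- **Lemma 5.9 (v) with the §2 slot PINNED, on the v2 record** (abc-iut-w4-d042's `cycRigidityCoincide_rho219OfBiTheta`): Prop. 5.5 BY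
NAME (v2 clause), the `Δ`-leg law of `ψ` (abc-iut-w4-d042's `IsDeltaLeg`, INLINED as `hψ`) and coverage ⟹
`CycRigidityCoincide (rho219OfBiTheta ψ) ρ hB`. [cite: MochizukiEtTh2009, Lem 5.9 (v) p.332 (PDF p.106)] -/
theorem cycRigidityCoincide_rho219OfBiTheta_galois
    (hi : ∀ x : 𝔉.EPiN, ((CycEnvelope.proj T.augY T.chi (i.e x) : T.PiY) : T.PiX) = ι (𝔉.toPiY x))
    (hYdd : 𝔉.PiYdd.map ι.toMonoidHom = T.PiYdd) (P : ThetaSubquotientProjGalois 𝔉 Gal) (ρ : RigidityFamily 𝔉)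
    (hB : 𝔉.IsThetaSaturated 𝔉.BN) (hρ : P.IsKummerDetermined ρ hB) (ψ : 𝔉.lDeltaModN 𝔉.BN ≃* T.mu)
    (hψ : ∀ (y : 𝔉.PiYdd) (_ : T.aug (ι (y : 𝔉.PiX)) = 1)
      (hh : ((𝔉.rhoYdd y : 𝔉.HB) : Aut (𝔉.base.obj 𝔉.BN)) ∈ P.pre (𝔉.base.obj 𝔉.BN)),
      ψ (QuotientGroup.mk (P.proj _ ⟨_, hh⟩)) = η ⟨ι (y : 𝔉.PiX), 𝔉.iota_mem_PiYdd T ι hYdd y⟩)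
    (hcov : ∀ x : 𝔉.lDeltaModN 𝔉.BN, ∃ (y : 𝔉.PiYdd) (_ : T.aug (ι (y : 𝔉.PiX)) = 1)
      (hh : ((𝔉.rhoYdd y : 𝔉.HB) : Aut (𝔉.base.obj 𝔉.BN)) ∈ P.pre (𝔉.base.obj 𝔉.BN)),
      (QuotientGroup.mk (P.proj _ ⟨_, hh⟩) : 𝔉.lDeltaModN 𝔉.BN) = x) :
    𝔉.CycRigidityCoincide (𝔉.rho219OfBiTheta h1 h3 hsec hcs h8 DK T ι hη i hi ψ) ρ hB :=
  𝔉.cycRigidityCoincide_of_biTheta_galois h1 h3 hsec hcs h8 DK T ι hη i hi hYdd P ρ hB hρ _ hcov fun y hy hh => by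
    rw [𝔉.biThetaIso_muIncl_rho219OfBiTheta h1 h3 hsec hcs h8 DK T ι hη i hi ψ, hψ y hy hh]

end Env

/-! ## 2. Over a rigidity interface `R : RigidData`: the `Δ`-leg law and coverage from the row-2 laws -/

section Rigid

variable {l : ℕ} (R : RigidData.{v} 𝔉.N l) (ι : 𝔉.PiX ≃ₜ* R.PiX)

/-- **The `Δ`-leg law from the row-2 laws ALONE, on the v2 record** (abc-iut-w4-d042's `isDeltaLeg_of_rowTwo`): (hlift) + (hP) + the
bi-theta isomorphism of (iv) ⟹ `ψ[proj(ρ y)] = η(ι y)` for every `y ∈ Π^tp_Ÿ̲` over `Δ` with `ρ y` in the pre-subgroup.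
[cite: MochizukiEtTh2009, Lem 5.9 (v) p.332 (PDF p.106); Prop 5.5 proof p.327 (PDF p.101)] -/
theorem deltaLeg_of_rowTwo_galois {η : R.PiYdd → R.mu} (hη : η ∈ R.thetaCocycles)
    (i : (𝔉.frdBiThetaEnv h1 h3 hsec hcs h8 DK).Iso (R.toThetaEnvData.modelBi hη))
    (hi : ∀ x : 𝔉.EPiN, ((CycEnvelope.proj R.augY R.chi (i.e x) : R.PiY) : R.PiX) = ι (𝔉.toPiY x))
    (hYdd : 𝔉.PiYdd.map ι.toMonoidHom = R.PiYdd) (P : ThetaSubquotientProjGalois 𝔉 Gal)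
    (ψ : 𝔉.lDeltaModN 𝔉.BN ≃* R.mu)
    (hlift : ∀ a ∈ 𝔉.HB, a ∈ P.pre (𝔉.base.obj 𝔉.BN) →
      ∃ k : 𝔉.PiYdd, ι (k : 𝔉.PiX) ∈ R.lDeltaTheta ∧ 𝔉.ρ (k : 𝔉.PiX) = a)
    (hP : ∀ (k : 𝔉.PiYdd) (hk : ι (k : 𝔉.PiX) ∈ R.lDeltaTheta) (hm : 𝔉.ρ (k : 𝔉.PiX) ∈ P.pre (𝔉.base.obj 𝔉.BN)),
      (QuotientGroup.mk (P.proj _ ⟨𝔉.ρ (k : 𝔉.PiX), hm⟩) : 𝔉.lDeltaModN 𝔉.BN) =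
        ψ.symm (R.thetaMod ⟨ι (k : 𝔉.PiX), hk⟩))
    (y : 𝔉.PiYdd) (hy : R.aug (ι (y : 𝔉.PiX)) = 1)
    (hh : ((𝔉.rhoYdd y : 𝔉.HB) : Aut (𝔉.base.obj 𝔉.BN)) ∈ P.pre (𝔉.base.obj 𝔉.BN)) :
    ψ (QuotientGroup.mk (P.proj _ ⟨_, hh⟩)) =
      η ⟨ι (y : 𝔉.PiX), 𝔉.iota_mem_PiYdd R.toThetaEnvData ι hYdd y⟩ := by
  obtain ⟨k, hk, hρ⟩ := hlift _ (𝔉.rhoYdd y).2 hh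
  have hm : 𝔉.ρ (k : 𝔉.PiX) ∈ P.pre (𝔉.base.obj 𝔉.BN) := by rw [hρ]; exact hh
  have hel : (⟨((𝔉.rhoYdd y : 𝔉.HB) : Aut (𝔉.base.obj 𝔉.BN)), hh⟩ : P.pre (𝔉.base.obj 𝔉.BN)) =
      ⟨𝔉.ρ (k : 𝔉.PiX), hm⟩ := Subtype.ext hρ.symm
  rw [hel, hP k hk hm, ψ.apply_symm_apply]
  refine (R.cocycle_lDeltaTheta η hη ⟨ι (k : 𝔉.PiX), 𝔉.iota_mem_PiYdd R.toThetaEnvData ι hYdd k⟩ hk).symm.trans ?_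
  exact 𝔉.biThetaIso_eta_eq_of_rho_eq h1 h3 hsec hcs h8 DK R.toThetaEnvData ι hη i hi hYdd k y
    (Subgroup.mem_inf.mp (R.lDeltaTheta_le hk)).2 hy hρ

omit h1 h3 hsec hcs h8 DK in
/-- **The coverage binder from the row-2 laws, on the v2 record** (abc-iut-w4-d042's `cover_of_laws`): every class of
`(l·Δ_Θ)_{B_N} ⊗ ℤ/Nℤ` is `[proj(ρ y)]` for some `y ∈ Π^tp_Ÿ̲` over `Δ`. [cite: MochizukiEtTh2009, §1 p.238 (PDF p.12); Prop 5.5 proof p.327 (PDF p.101)] -/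
theorem cover_of_laws_galois (hYdd : 𝔉.PiYdd.map ι.toMonoidHom = R.PiYdd) (P : ThetaSubquotientProjGalois 𝔉 Gal)
    (ψ : 𝔉.lDeltaModN 𝔉.BN ≃* R.mu)
    (hpre : ∀ k : 𝔉.PiYdd, ι (k : 𝔉.PiX) ∈ R.lDeltaTheta → 𝔉.ρ (k : 𝔉.PiX) ∈ P.pre (𝔉.base.obj 𝔉.BN))
    (hP : ∀ (k : 𝔉.PiYdd) (hk : ι (k : 𝔉.PiX) ∈ R.lDeltaTheta) (hm : 𝔉.ρ (k : 𝔉.PiX) ∈ P.pre (𝔉.base.obj 𝔉.BN)),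
      (QuotientGroup.mk (P.proj _ ⟨𝔉.ρ (k : 𝔉.PiX), hm⟩) : 𝔉.lDeltaModN 𝔉.BN) =
        ψ.symm (R.thetaMod ⟨ι (k : 𝔉.PiX), hk⟩))
    (x : 𝔉.lDeltaModN 𝔉.BN) :
    ∃ (y : 𝔉.PiYdd) (_ : R.aug (ι (y : 𝔉.PiX)) = 1)
      (hh : ((𝔉.rhoYdd y : 𝔉.HB) : Aut (𝔉.base.obj 𝔉.BN)) ∈ P.pre (𝔉.base.obj 𝔉.BN)),
      (QuotientGroup.mk (P.proj _ ⟨_, hh⟩) : 𝔉.lDeltaModN 𝔉.BN) = x := by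
  obtain ⟨g, hg⟩ := R.thetaMod_surjective (ψ x)
  have hgY : (g : R.PiX) ∈ R.PiYdd := (Subgroup.mem_inf.mp (R.lDeltaTheta_le g.2)).1
  have hgaug : R.aug (g : R.PiX) = 1 := (Subgroup.mem_inf.mp (R.lDeltaTheta_le g.2)).2
  let y : 𝔉.PiYdd := ⟨ι.symm (g : R.PiX), 𝔉.iota_symm_mem_PiYdd R ι hYdd ⟨_, hgY⟩⟩
  have hιy : ι (y : 𝔉.PiX) = (g : R.PiX) := ι.apply_symm_apply _
  have hk : ι (y : 𝔉.PiX) ∈ R.lDeltaTheta := by rw [hιy]; exact g.2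
  have hgk : (⟨ι (y : 𝔉.PiX), hk⟩ : R.lDeltaTheta) = g := Subtype.ext hιy
  refine ⟨y, by rw [hιy]; exact hgaug, hpre y hk, (hP y hk (hpre y hk)).trans ?_⟩
  rw [hgk, hg, ψ.symm_apply_apply]

/-- **Lemma 5.9 (v), §2 slot pinned, from Prop. 5.5 BY NAME + the row-2 laws ONLY, on the v2 record** (abc-iut-w4-d042's
`cycRigidityCoincide_rho219OfBiTheta_of_rowTwo`). [cite: MochizukiEtTh2009, Lem 5.9 (v) p.332 (PDF p.106)] -/
theorem cycRigidityCoincide_rho219OfBiTheta_of_rowTwo_galois {η : R.PiYdd → R.mu} (hη : η ∈ R.thetaCocycles)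
    (i : (𝔉.frdBiThetaEnv h1 h3 hsec hcs h8 DK).Iso (R.toThetaEnvData.modelBi hη))
    (hi : ∀ x : 𝔉.EPiN, ((CycEnvelope.proj R.augY R.chi (i.e x) : R.PiY) : R.PiX) = ι (𝔉.toPiY x))
    (hYdd : 𝔉.PiYdd.map ι.toMonoidHom = R.PiYdd) (P : ThetaSubquotientProjGalois 𝔉 Gal)
    (ρf : RigidityFamily 𝔉) (hB : 𝔉.IsThetaSaturated 𝔉.BN) (hρf : P.IsKummerDetermined ρf hB)
    (ψ : 𝔉.lDeltaModN 𝔉.BN ≃* R.mu)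
    (hpre : ∀ k : 𝔉.PiYdd, ι (k : 𝔉.PiX) ∈ R.lDeltaTheta → 𝔉.ρ (k : 𝔉.PiX) ∈ P.pre (𝔉.base.obj 𝔉.BN))
    (hlift : ∀ a ∈ 𝔉.HB, a ∈ P.pre (𝔉.base.obj 𝔉.BN) →
      ∃ k : 𝔉.PiYdd, ι (k : 𝔉.PiX) ∈ R.lDeltaTheta ∧ 𝔉.ρ (k : 𝔉.PiX) = a)
    (hP : ∀ (k : 𝔉.PiYdd) (hk : ι (k : 𝔉.PiX) ∈ R.lDeltaTheta) (hm : 𝔉.ρ (k : 𝔉.PiX) ∈ P.pre (𝔉.base.obj 𝔉.BN)),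
      (QuotientGroup.mk (P.proj _ ⟨𝔉.ρ (k : 𝔉.PiX), hm⟩) : 𝔉.lDeltaModN 𝔉.BN) =
        ψ.symm (R.thetaMod ⟨ι (k : 𝔉.PiX), hk⟩)) :
    𝔉.CycRigidityCoincide (𝔉.rho219OfBiTheta h1 h3 hsec hcs h8 DK R.toThetaEnvData ι hη i hi ψ) ρf hB :=
  𝔉.cycRigidityCoincide_rho219OfBiTheta_galois h1 h3 hsec hcs h8 DK R.toThetaEnvData ι hη i hi hYdd P ρf hB hρf ψ
    (𝔉.deltaLeg_of_rowTwo_galois h1 h3 hsec hcs h8 DK R ι hη i hi hYdd P ψ hlift hP)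
    (𝔉.cover_of_laws_galois R ι hYdd P ψ hpre hP)

/-! ## 3. The consumer head of record, RE-KEYED -/

/-- **THE RE-KEYED HEAD — [EtTh] Lemma 5.9 (v), §2 slot pinned, from Lemma 5.9 (iv) BY NAME + Prop. 5.5 BY NAME + the row-2 laws, binding
the v2 record `P : ThetaSubquotientProjGalois 𝔉 Gal`** (abc-iut-w4-d042's p471697 head `cycRigidityCoincide_rho219_of_envIsoBiTheta_of_rowTwo`
with the binder type changed and the Prop. 5.5 clause read on the v2 record; `(η, i)` of (iv) extracted by choice): `ρ_{B_N} = rho219OfBiTheta ψ`.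
At abc-iut-L2-t9's carrier this head quantifies over an INHABITED type (`Sec5ThetaSubquotientProjGaloisInhabited`), where the v1 head does not.
[cite: MochizukiEtTh2009, Lem 5.9 (v) p.332 (PDF p.106)] -/
theorem cycRigidityCoincide_rho219_of_envIsoBiTheta_of_rowTwo_galois
    (h59iv : 𝔉.EnvIsoBiTheta h1 h3 hsec hcs h8 DK R.toThetaEnvData ι) (P : ThetaSubquotientProjGalois 𝔉 Gal)
    (ρf : RigidityFamily 𝔉) (hB : 𝔉.IsThetaSaturated 𝔉.BN) (hρf : P.IsKummerDetermined ρf hB)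
    (ψ : 𝔉.lDeltaModN 𝔉.BN ≃* R.mu)
    (hpre : ∀ k : 𝔉.PiYdd, ι (k : 𝔉.PiX) ∈ R.lDeltaTheta → 𝔉.ρ (k : 𝔉.PiX) ∈ P.pre (𝔉.base.obj 𝔉.BN))
    (hlift : ∀ a ∈ 𝔉.HB, a ∈ P.pre (𝔉.base.obj 𝔉.BN) →
      ∃ k : 𝔉.PiYdd, ι (k : 𝔉.PiX) ∈ R.lDeltaTheta ∧ 𝔉.ρ (k : 𝔉.PiX) = a)
    (hP : ∀ (k : 𝔉.PiYdd) (hk : ι (k : 𝔉.PiX) ∈ R.lDeltaTheta) (hm : 𝔉.ρ (k : 𝔉.PiX) ∈ P.pre (𝔉.base.obj 𝔉.BN)),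
      (QuotientGroup.mk (P.proj _ ⟨𝔉.ρ (k : 𝔉.PiX), hm⟩) : 𝔉.lDeltaModN 𝔉.BN) =
        ψ.symm (R.thetaMod ⟨ι (k : 𝔉.PiX), hk⟩)) :
    𝔉.CycRigidityCoincide
      (𝔉.rho219OfBiTheta h1 h3 hsec hcs h8 DK R.toThetaEnvData ι h59iv.2.2.choose_spec.choose
        h59iv.2.2.choose_spec.choose_spec.choose h59iv.2.2.choose_spec.choose_spec.choose_spec.1 ψ) ρf hB :=
  𝔉.cycRigidityCoincide_rho219OfBiTheta_of_rowTwo_galois h1 h3 hsec hcs h8 DK R ι _ _ _ h59iv.2.1 P ρf hB hρf ψ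
    hpre hlift hP

/-- **Twin check**: abc-iut-w4-d042's v1 head is the re-keyed head at `P.toGalois Gal` (the Prop. 5.5 clause transfers by
`isKummerDetermined_toGalois_iff`, `pre`/`proj` are unchanged) — the v1 heads are instances of the v2 head; nothing of p471697 is edited.
[cite: MochizukiEtTh2009, Lem 5.9 (v) p.332 (PDF p.106)] -/
theorem cycRigidityCoincide_rho219_of_envIsoBiTheta_of_rowTwo_of_toGalois (Gal : D → Prop)
    (h59iv : 𝔉.EnvIsoBiTheta h1 h3 hsec hcs h8 DK R.toThetaEnvData ι) (P : ThetaSubquotientProj 𝔉)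
    (ρf : RigidityFamily 𝔉) (hB : 𝔉.IsThetaSaturated 𝔉.BN) (hρf : IsKummerDetermined 𝔉 P ρf hB)
    (ψ : 𝔉.lDeltaModN 𝔉.BN ≃* R.mu)
    (hpre : ∀ k : 𝔉.PiYdd, ι (k : 𝔉.PiX) ∈ R.lDeltaTheta → 𝔉.ρ (k : 𝔉.PiX) ∈ P.pre (𝔉.base.obj 𝔉.BN))
    (hlift : ∀ a ∈ 𝔉.HB, a ∈ P.pre (𝔉.base.obj 𝔉.BN) →
      ∃ k : 𝔉.PiYdd, ι (k : 𝔉.PiX) ∈ R.lDeltaTheta ∧ 𝔉.ρ (k : 𝔉.PiX) = a)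
    (hP : ∀ (k : 𝔉.PiYdd) (hk : ι (k : 𝔉.PiX) ∈ R.lDeltaTheta) (hm : 𝔉.ρ (k : 𝔉.PiX) ∈ P.pre (𝔉.base.obj 𝔉.BN)),
      (QuotientGroup.mk (P.proj _ ⟨𝔉.ρ (k : 𝔉.PiX), hm⟩) : 𝔉.lDeltaModN 𝔉.BN) =
        ψ.symm (R.thetaMod ⟨ι (k : 𝔉.PiX), hk⟩)) :
    𝔉.CycRigidityCoincide
      (𝔉.rho219OfBiTheta h1 h3 hsec hcs h8 DK R.toThetaEnvData ι h59iv.2.2.choose_spec.choose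
        h59iv.2.2.choose_spec.choose_spec.choose h59iv.2.2.choose_spec.choose_spec.choose_spec.1 ψ) ρf hB :=
  𝔉.cycRigidityCoincide_rho219_of_envIsoBiTheta_of_rowTwo_galois h1 h3 hsec hcs h8 DK R ι h59iv (P.toGalois Gal) ρf hB
    ((ThetaSubquotientProjGalois.isKummerDetermined_toGalois_iff Gal P ρf hB).2 hρf) ψ hpre hlift hP

end Rigid

end ThetaFrobenioid

end Literature.AnabelianGeometry.EtaleTheta

end
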